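import Literature.Topology.FourManifolds.ResolutionNeckPiece
import HarnessLib

/-!
# The three parameter zones of a sheet of `Σ̄₂` from two disjoint charts

General bookkeeping (topic `Literature/Topology/FourManifolds`; everything PROVED, no
definitions) for the assembly of the tube of the genus-2 surface `Σ̄₂ ⊂ T⁴ # ℂℙ²bar` of
Akhmedov–Park (Invent. Math. 181 (2010), §3).  On a sheet `F` (a torus) two charts with full
target, `e₂` at the neck point `x₂` and `e₃` at the cap point, with complex coordinates
`A₂ = cx ∘ e₂`, `A₃ = cx ∘ e₃`, define the NECK zone `U_N = {0 < ‖A₂‖ < R_N}`, the CAP zone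
`U_C = {‖A₃‖ < R_C}` and the FAR zone `U_F = F ∖ (e₂⁻¹ B̄(0, r_N) ∪ e₃⁻¹ B̄(0, r_C))`
(`r_N < R_N`, `r_C < R_C`).  We prove (`twoChartZones`): `U_F` is open (the removed sets are
compact images), `U_F ∩ U_N ⊆ {r_N < ‖A₂‖}`, `U_F ∩ U_C ⊆ {r_C < ‖A₃‖}`, every point other than
`x₂` lies in one of the three zones, and `U_F` misses `x₂` and the centre of `e₃`.

## References

* A. Akhmedov, B. D. Park, Invent. Math. 181 (2010) 577–603, §3. [AkhmedovPark2010]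
-/

noncomputable section

open scoped Manifold ContDiff Topology
open Set Function Complex Metric

namespace Literature.Topology.FourManifolds

namespace TwoChartZones

variable {F : Type} [TopologicalSpace F] [T2Space F]
  {cx : EuclideanSpace ℝ (Fin 2) → ℂ}
  {e₂ e₃ : OpenPartialHomeomorph F (EuclideanSpace ℝ (Fin 2))} {A₂ A₃ : F → ℂ} {x₂ x₃ : F}
  {rN RN rC RC : ℝ} {UN UC UF : Set F}

variable (hcx : ∀ v, cx v = ⟨v 0, v 1⟩)
  (he₂t : e₂.target = univ) (he₃t : e₃.target = univ)
  (hA₂ : ∀ p, A₂ p = cx (e₂ p)) (hA₃ : ∀ p, A₃ p = cx (e₃ p))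
  (hx₂ : x₂ ∈ e₂.source ∧ A₂ x₂ = 0) (hx₃ : x₃ ∈ e₃.source ∧ A₃ x₃ = 0)
  (hrN : 0 ≤ rN) (hrRN : rN < RN) (hrC : 0 ≤ rC) (hrRC : rC < RC)
  (hUN : UN = {p | p ∈ e₂.source ∧ A₂ p ≠ 0 ∧ ‖A₂ p‖ < RN})
  (hUC : UC = {p | p ∈ e₃.source ∧ ‖A₃ p‖ < RC})
  (hUF : UF = {p | p ∉ e₂.symm '' closedBall (0 : EuclideanSpace ℝ (Fin 2)) rN ∧
    p ∉ e₃.symm '' closedBall (0 : EuclideanSpace ℝ (Fin 2)) rC})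

omit [T2Space F] in
include hcx in
/-- The preimage of a closed coordinate ball under a chart with full target is the image of the
ball under the inverse chart, a compact (hence closed) set; membership criterion. [folklore] -/
theorem mem_symm_image_closedBall_iff {e : OpenPartialHomeomorph F (EuclideanSpace ℝ (Fin 2))}
    (het : e.target = univ) {A : F → ℂ} (hA : ∀ p, A p = cx (e p)) {r : ℝ} {p : F} :
    p ∈ e.symm '' closedBall (0 : EuclideanSpace ℝ (Fin 2)) r ↔ p ∈ e.source ∧ ‖A p‖ ≤ r := by
  constructor
  · rintro ⟨v, hv, rfl⟩
    have hvt : v ∈ e.target := by rw [het]; exact mem_univ v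
    refine ⟨e.map_target hvt, ?_⟩
    rw [hA, e.right_inv hvt, NeckPiece.norm_cx hcx]
    exact mem_closedBall_zero_iff.1 hv
  · rintro ⟨hp, hr⟩
    refine ⟨e p, ?_, e.left_inv hp⟩
    rw [mem_closedBall_zero_iff, ← NeckPiece.norm_cx hcx, ← hA]; exact hr

omit [T2Space F] in
/-- The image of a closed coordinate ball under the inverse of a chart with full target is
compact. [folklore] -/
theorem isCompact_symm_image_closedBall {e : OpenPartialHomeomorph F (EuclideanSpace ℝ (Fin 2))}
    (het : e.target = univ) (r : ℝ) :
    IsCompact (e.symm '' closedBall (0 : EuclideanSpace ℝ (Fin 2)) r) :=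
  (isCompact_closedBall 0 r).image_of_continuousOn (e.continuousOn_symm.mono (by rw [het]; exact subset_univ _))

include hcx he₂t he₃t hA₂ hA₃ hx₂ hx₃ hrN hrRN hrC hrRC hUN hUC hUF in
/-- **The three zones.**  `U_F` is open; `U_F ∩ U_N ⊆ {r_N < ‖A₂‖}`; `U_F ∩ U_C ⊆ {r_C < ‖A₃‖}`;
every `p ≠ x₂` lies in `U_N ∪ U_C ∪ U_F`; `U_F` misses `x₂` and `x₃`. [cite: AkhmedovPark2010, §3] -/
theorem twoChartZones :
    IsOpen UF ∧ (∀ p ∈ UF, p ∈ UN → rN < ‖A₂ p‖) ∧ (∀ p ∈ UF, p ∈ UC → rC < ‖A₃ p‖) ∧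
      (∀ p, p ≠ x₂ → p ∈ UN ∨ p ∈ UC ∨ p ∈ UF) ∧ (∀ p ∈ UF, p ≠ x₂ ∧ p ≠ x₃) := by
  have hK₂ := (isCompact_symm_image_closedBall (e := e₂) he₂t rN).isClosed
  have hK₃ := (isCompact_symm_image_closedBall (e := e₃) he₃t rC).isClosed
  have hm₂ : ∀ {p}, p ∈ e₂.symm '' closedBall (0 : EuclideanSpace ℝ (Fin 2)) rN ↔
      p ∈ e₂.source ∧ ‖A₂ p‖ ≤ rN := fun {p} => mem_symm_image_closedBall_iff hcx he₂t hA₂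
  have hm₃ : ∀ {p}, p ∈ e₃.symm '' closedBall (0 : EuclideanSpace ℝ (Fin 2)) rC ↔
      p ∈ e₃.source ∧ ‖A₃ p‖ ≤ rC := fun {p} => mem_symm_image_closedBall_iff hcx he₃t hA₃
  -- `A₂` vanishes only at `x₂` on the chart domain
  have hinj : ∀ p ∈ e₂.source, A₂ p = 0 → p = x₂ := fun p hp h0 => by
    have h1 : e₂ p = e₂ x₂ := by
      apply NeckPiece.cx_injective hcx
      rw [← hA₂, ← hA₂, h0, hx₂.2]
    exact e₂.injOn hp hx₂.1 h1
  refine ⟨?_, ?_, ?_, ?_, ?_⟩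
  · rw [hUF]
    exact (hK₂.isOpen_compl.inter hK₃.isOpen_compl)
  · intro p hpF hpN
    rw [hUF] at hpF; rw [hUN] at hpN
    by_contra hle
    exact hpF.1 (hm₂.2 ⟨hpN.1, not_lt.1 hle⟩)
  · intro p hpF hpC
    rw [hUF] at hpF; rw [hUC] at hpC
    by_contra hle
    exact hpF.2 (hm₃.2 ⟨hpC.1, not_lt.1 hle⟩)
  · intro p hp
    by_cases h2 : p ∈ e₂.symm '' closedBall (0 : EuclideanSpace ℝ (Fin 2)) rN
    · obtain ⟨hps, hle⟩ := hm₂.1 h2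
      refine Or.inl ?_
      rw [hUN]
      exact ⟨hps, fun h0 => hp (hinj p hps h0), by linarith⟩
    · by_cases h3 : p ∈ e₃.symm '' closedBall (0 : EuclideanSpace ℝ (Fin 2)) rC
      · obtain ⟨hps, hle⟩ := hm₃.1 h3
        refine Or.inr (Or.inl ?_)
        rw [hUC]
        exact ⟨hps, by linarith⟩
      · refine Or.inr (Or.inr ?_)
        rw [hUF]; exact ⟨h2, h3⟩
  · intro p hpF
    rw [hUF] at hpF
    constructor
    · rintro rfl
      exact hpF.1 (hm₂.2 ⟨hx₂.1, by rw [hx₂.2, norm_zero]; exact hrN⟩)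
    · rintro rfl
      exact hpF.2 (hm₃.2 ⟨hx₃.1, by rw [hx₃.2, norm_zero]; exact hrC⟩)

end TwoChartZones

end Literature.Topology.FourManifolds
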